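import Summits.BirchSwinnertonDyer.Rank1Residual.X11b.Three.GoodReductionSubgroupGaloisH1
import HarnessLib

/-!
# X11b at `p = 3` (team N8/O2), JET3-KUMMER (α), the `Ẽ_ns` half: reduction of the stub `h1red`
# to a surjective equivariant reduction map and Hilbert 90 for a finite cyclic group

HONEST FRAMING (cell `b2b-bsdres`, run/shared/lean/b2b/bsd-rank1-residual/, verbatim in every
file): the goal of the cell is to DELETE the COMBINATION-SHAPED residual classes of the
Birch–Swinnerton-Dyer formula for ALL analytic-rank `≤ 1` elliptic curves over `ℚ` — "full BSD
formula for every rank `≤ 1` curve in class `C`" assembled STRICTLY from published theorems — so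
that the rank-`≤ 1` remainder becomes exactly the CONSTRUCTION-SHAPED classes, which are TYPED
(missing-input `Prop`s), NOT attempted. This is not "finishing BSD". Team N8/O2 = `x11b3`, seat
`b2b-bsdres-x11b3-p4`, LEAD DEAL #4 row "JET3-KUMMER help-wanted (d) + (α)", part 3: the stub
`h1red` of `GoodReductionSubgroupGaloisH1.lean` (the `Ẽ_ns` half of (α), LIFTED to `E₀(L)`) is
REDUCED to print-shaped inputs. THEOREMS ONLY: no definition, no named fact, no `sorry`; nothing
is booked; the flag `JET@p|N` is NOT discharged.

## What

Recall (part 2, `hα_of_cyclic_of_halves`): with `Gal(L/F) = ⟨φ⟩`, `φⁿ = 1`, p1's hypothesis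
`hα` follows from two stubs on a subset `E₁ ⊆ E₀(L)`; the second one is
`h1red : ∀ m ∈ E₀(L), Σ_{j<n} φʲ m = O → ∃ C ∈ E₀(L), m − (φ C − C) ∈ E₁`.
Here `h1red` is derived, for `E₁ = ker r`, from

* a **surjective reduction map** `r : E₀(L) →+ C` onto an abelian group `C` (printed:
  `E₀(L) ↠ Ẽ_ns(k)`, Silverman *AEC* VII.2.1, surjective by Hensel — tree
  `WeierstrassCurve.reductionHom_surjective`; at a MULTIPLICATIVE place followed by
  `ψ : Ẽ_ns(k) ≅ kˣ` at a presented node — tree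
  `WeierstrassCurve.exists_addMonoidHom_units_of_map_eq_singularModel`, kernel `E₁(L)`),
* which is **equivariant** for an endomorphism `φ_C` of `C`: `r(φ P) = φ_C (r P)` (printed: the
  decomposition group acts on `Ẽ_ns(k)` through the residue field; at a node
  `r(φ P) = φ̄(r P)` if `φ̄` fixes the tangent slopes and `r(φ P) = φ̄(r P)⁻¹` if it swaps them —
  Silverman *AEC* Exercise 3.5(a), tree `WeierstrassCurve.exists_residueMap_nodeReduction_smul`),
* and **`H¹(⟨φ_C⟩, C) = 0` in cyclic form**: every `c` with `Σ_{j<n} φ_Cʲ c = 0` is `φ_C c' − c'`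
  (`cyclicH1_of_reductionMap`, `h1red_of_reductionMap`);

and the last input is PROVED for the targets that occur at a multiplicative place: a cyclic group
`C = ⟨g⟩` of order `N` (printed: `kˣ`, `N = qⁿ − 1`, `q = #k₀`, `n = [k : k₀]`) with `φ_C` the
multiplication by an integer `a` such that `(Σ_{j<n} aʲ)·(a − 1) = N`
(`exists_sub_smul_eq_of_smul_eq_zero`, `cyclicH1_zsmul_of_cyclic`; SPLIT node: `a = q`, `(Σ qʲ)(q − 1) = qⁿ − 1` — Hilbert's
Theorem 90 for `k/k₀`; NON-SPLIT node becoming split over `k`, `n` even: `a = −q`,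
`(Σ (−q)ʲ)(−q − 1) = qⁿ − 1`; both identities are `sum_pow_mul_sub_one`,
`sum_neg_pow_mul_of_even`). Assembled: `h1red_of_reductionMap_of_cyclic`.

What then remains OPEN in `h1red` at a multiplicative `v` is only the INSTANTIATION of `r` on the
tree's objects (the node presentation of the reduction over `k`, `#kˣ = qⁿ − 1`, `φ̄ = x ↦ x^q` for
the Frobenius `φ` of the unramified `L/F`) — bookkeeping in the setting of
`NodeReductionGaloisProofs` (`w : Valuation L ℝ≥0`, `W₀` over `w.integer`), not done here because
p1's `JetchevKummerAtP` is phrased with an abstract discrete valuation ring `R`.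

References (locators only; no new fact): [cite: SilvermanAEC2009, VII.2 Prop. 2.1 (PDF p. 167),
Exercise 3.5(a) (PDF p. 97), VII.§5 (PDF p. 174)] [cite: MilneADT2006, Ch. I Prop. 3.8]
[cite: SerreLocalFields1979, VIII §4 (cohomology of finite cyclic groups), X §1 (Hilbert 90)].

## Design

No definitions; `noncomputable section`; `open scoped Classical`; pure algebra first (any
`AddCommGroup`s `B`, `C`, endomorphisms `φ_B`, `φ_C`), then the bridge to the `(A, D, B ≤ A)`
language of part 2 and to p1's points. Axioms: `propext`, `Classical.choice`, `Quot.sound`.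
-/

noncomputable section

open scoped Classical

namespace Summit.BirchSwinnertonDyer.Rank1Residual.X11b.Three.JetchevKummer

open WeierstrassCurve

universe u

/-! ### §1 `h1red` from a surjective equivariant reduction map (pure algebra) -/

section ReductionMap

variable {B C : Type*} [AddCommGroup B] [AddCommGroup C]

/-- Equivariance for the iterates: `r (φ_B^j b) = φ_C^j (r b)`. [folklore] -/
theorem apply_iterate_eq_iterate_apply (φB : B →+ B) (φC : C →+ C) (r : B →+ C)
    (hcomm : ∀ b, r (φB b) = φC (r b)) (j : ℕ) (b : B) :
    r ((⇑φB)^[j] b) = (⇑φC)^[j] (r b) := by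
  induction j generalizing b with
  | zero => rfl
  | succ j ih => rw [Function.iterate_succ_apply, Function.iterate_succ_apply, ih, hcomm]

/-- **`H¹` dévissage along a surjective equivariant map, cyclic form.** Let `r : B ↠ C` be a
surjective homomorphism intertwining endomorphisms `φ_B`, `φ_C`. If every `c ∈ C` with
`Σ_{j<n} φ_Cʲ c = 0` is of the form `φ_C c' − c'`, then every `m ∈ B` with `Σ_{j<n} φ_Bʲ m = 0`
is congruent modulo `ker r` to some `φ_B b − b`: reduce `m`, solve in `C`, lift the solution
(the exactness of `H¹(B) → H¹(C)`-type bookkeeping behind Silverman *AEC* VII.2.1 /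
Milne *ADT* I.3.8). [folklore] -/
theorem cyclicH1_of_reductionMap (φB : B →+ B) (φC : C →+ C) (r : B →+ C)
    (hr : Function.Surjective r) (hcomm : ∀ b, r (φB b) = φC (r b)) {n : ℕ}
    (h90 : ∀ c : C, ∑ j ∈ Finset.range n, (⇑φC)^[j] c = 0 → ∃ c' : C, φC c' - c' = c)
    (m : B) (hm : ∑ j ∈ Finset.range n, (⇑φB)^[j] m = 0) :
    ∃ b : B, m - (φB b - b) ∈ r.ker := by
  have hc : ∑ j ∈ Finset.range n, (⇑φC)^[j] (r m) = 0 := by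
    have := congrArg r hm
    rw [map_sum, map_zero] at this
    simpa only [apply_iterate_eq_iterate_apply φB φC r hcomm] using this
  obtain ⟨c', hc'⟩ := h90 (r m) hc
  obtain ⟨b, rfl⟩ := hr c'
  refine ⟨b, ?_⟩
  rw [AddMonoidHom.mem_ker, map_sub, map_sub, hcomm, hc', sub_self]

end ReductionMap

/-! ### §2 Hilbert 90 for a finite cyclic group with `φ_C = a •` and `(Σ aʲ)(a − 1) = N` -/

section CyclicGroup

variable {C : Type*} [AddCommGroup C]

/-- `Σ_{j<n} (a • )ʲ c = (Σ_{j<n} aʲ) • c`. [folklore] -/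
theorem sum_iterate_zsmul (a : ℤ) (n : ℕ) (c : C) :
    ∑ j ∈ Finset.range n, (fun x : C ↦ a • x)^[j] c = (∑ j ∈ Finset.range n, a ^ j) • c := by
  have hit : ∀ j : ℕ, (fun x : C ↦ a • x)^[j] c = a ^ j • c := by
    intro j
    induction j with
    | zero => simp
    | succ j ih => rw [Function.iterate_succ_apply', ih, smul_smul, pow_succ']
  simp only [hit, Finset.sum_smul]

/-- **Hilbert 90 in a finite cyclic group, arithmetic form.** Let `C = ⟨g⟩` be cyclic with `g` of
order `N > 0`, `a ∈ ℤ`, and `S ∈ ℤ` with `S · (a − 1) = N` (in the application `S = Σ_{j<n} aʲ`).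
Then every `c ∈ C` with `S • c = 0` is `(a − 1) • c'`: writing `c = b • g`, `N ∣ S b` forces
`(a − 1) ∣ b`. (For `C = kˣ`, `#k = qⁿ`: `a = q` is Hilbert's Theorem 90 for the cyclic
extension `k/k₀` of finite fields, `N_{k/k₀}(u) = 1 ⇒ u = c^{q−1}`; `a = −q` with `n` even is the
twisted form `∏ u^{(−q)ʲ} = 1 ⇒ u = c^{−q−1}` met at a non-split node that splits over `k`.)
Serre, *Local Fields* VIII §4, X §1. [folklore] -/
theorem exists_sub_smul_eq_of_smul_eq_zero (g : C) (hg : ∀ c : C, c ∈ AddSubgroup.zmultiples g)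
    {N : ℕ} (hN : addOrderOf g = N) (hN0 : 0 < N) {a S : ℤ} (hS : S * (a - 1) = N)
    (c : C) (hc : S • c = 0) : ∃ c' : C, (a - 1) • c' = c := by
  obtain ⟨b, rfl⟩ := AddSubgroup.mem_zmultiples_iff.mp (hg c)
  have hdvd : (N : ℤ) ∣ S * b := by
    rw [← hN]
    exact addOrderOf_dvd_iff_zsmul_eq_zero.mpr (by rw [mul_smul]; exact hc)
  have hS0 : S ≠ 0 := by
    rintro rfl
    rw [zero_mul] at hS
    omega
  rw [← hS, mul_dvd_mul_iff_left hS0] at hdvd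
  obtain ⟨e, rfl⟩ := hdvd
  exact ⟨e • g, by rw [smul_smul]⟩

/-- `H¹(⟨φ_C⟩, C) = 0` in cyclic form for `φ_C = a •` on a cyclic group `C = ⟨g⟩` of order `N`
with `(Σ_{j<n} aʲ)(a − 1) = N`: every `c` with `Σ_{j<n} φ_Cʲ c = 0` is `φ_C c' − c'`.
Serre, *Local Fields* VIII §4. [folklore] -/
theorem cyclicH1_zsmul_of_cyclic (g : C) (hg : ∀ c : C, c ∈ AddSubgroup.zmultiples g)
    {N : ℕ} (hN : addOrderOf g = N) (hN0 : 0 < N) (φC : C →+ C) {a : ℤ}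
    (hφC : ∀ c, φC c = a • c) {n : ℕ} (hS : (∑ j ∈ Finset.range n, a ^ j) * (a - 1) = N)
    (c : C) (hc : ∑ j ∈ Finset.range n, (⇑φC)^[j] c = 0) : ∃ c' : C, φC c' - c' = c := by
  have hfun : (⇑φC) = fun x : C ↦ a • x := funext hφC
  rw [hfun, sum_iterate_zsmul] at hc
  obtain ⟨c', hc'⟩ := exists_sub_smul_eq_of_smul_eq_zero g hg hN hN0 hS c hc
  exact ⟨c', by rw [hφC, ← hc', sub_smul, one_smul]⟩

/-- The split case `a = q`: `(Σ_{j<n} qʲ)(q − 1) = qⁿ − 1` (Mathlib `geom_sum_mul`). [folklore] -/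
theorem sum_pow_mul_sub_one (q : ℤ) (n : ℕ) :
    (∑ j ∈ Finset.range n, q ^ j) * (q - 1) = q ^ n - 1 :=
  geom_sum_mul q n

/-- The non-split case `a = −q`, `n` even: `(Σ_{j<n} (−q)ʲ)(−q − 1) = qⁿ − 1`. [folklore] -/
theorem sum_neg_pow_mul_of_even (q : ℤ) {n : ℕ} (hn : Even n) :
    (∑ j ∈ Finset.range n, (-q) ^ j) * (-q - 1) = q ^ n - 1 := by
  rw [geom_sum_mul, hn.neg_pow]

end CyclicGroup

/-! ### §3 Back to `E₀(L) ≤ E(L)` with its `Gal(L/F)`-action: the stub `h1red` from a reduction map -/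

section Bridge

variable {D A C : Type*} [Group D] [AddCommGroup A] [DistribMulAction D A] [AddCommGroup C]

/-- Iterates of the restriction `φ_B` of `φ` to the stable subgroup `B` are the powers of `φ`.
[folklore] -/
theorem coe_iterate_eq_pow_smul (B : AddSubgroup A) {φ : D} (φB : B →+ B)
    (hφB : ∀ b : B, ((φB b : B) : A) = φ • (b : A)) (j : ℕ) (b : B) :
    (((⇑φB)^[j] b : B) : A) = φ ^ j • (b : A) := by
  induction j generalizing b with
  | zero => simp
  | succ j ih => rw [Function.iterate_succ_apply, ih, hφB, smul_smul, ← pow_succ]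

/-- **The stub `h1red` from a surjective equivariant reduction map.** Let `B ≤ A` be `φ`-stable
with restriction `φ_B`, `r : B ↠ C` surjective with `r ∘ φ_B = φ_C ∘ r`, and suppose
`H¹(⟨φ_C⟩, C) = 0` in cyclic form. Then every `m ∈ B` with `Σ_{j<n} φʲ m = 0` is congruent to some
`φ c − c`, `c ∈ B`, modulo `E₁ := ker r` (viewed in `A`) — the hypothesis `h1red` of
`hα_of_cyclic_of_halves` / `cyclicH1_of_subset` for this `E₁`. Printed: `E₀(L) ↠ Ẽ_ns(k)`
equivariantly with kernel `E₁(L)` and `H¹(Gal(k/k₀), Ẽ_ns(k)) = 0` (Silverman *AEC* VII.2.1;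
Milne *ADT* I.3.8). [folklore] -/
theorem h1red_of_reductionMap (B : AddSubgroup A) {φ : D} (φB : B →+ B)
    (hφB : ∀ b : B, ((φB b : B) : A) = φ • (b : A)) (φC : C →+ C) (r : B →+ C)
    (hr : Function.Surjective r) (hcomm : ∀ b, r (φB b) = φC (r b)) {n : ℕ}
    (h90 : ∀ c : C, ∑ j ∈ Finset.range n, (⇑φC)^[j] c = 0 → ∃ c' : C, φC c' - c' = c) :
    ∀ m ∈ B, ∑ j ∈ Finset.range n, φ ^ j • m = 0 →
      ∃ c ∈ B, m - (φ • c - c) ∈ (r.ker.map B.subtype : Set A) := by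
  intro m hm hs
  have hsB : ∑ j ∈ Finset.range n, (⇑φB)^[j] ⟨m, hm⟩ = 0 := by
    apply Subtype.ext
    rw [AddSubgroup.val_finsetSum, AddSubgroup.coe_zero]
    simpa only [coe_iterate_eq_pow_smul B φB hφB] using hs
  obtain ⟨b, hb⟩ := cyclicH1_of_reductionMap φB φC r hr hcomm h90 ⟨m, hm⟩ hsB
  refine ⟨b, b.2, ?_⟩
  refine ⟨⟨m, hm⟩ - (φB b - b), hb, ?_⟩
  rw [AddSubgroup.subtype_apply, AddSubgroup.coe_sub, AddSubgroup.coe_sub, hφB]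

/-- `ker r ⊆ B` (as subsets of `A`). [folklore] -/
theorem coe_map_ker_subtype_subset (B : AddSubgroup A) (r : B →+ C) :
    (r.ker.map B.subtype : Set A) ⊆ B := by
  rintro _ ⟨b, -, rfl⟩
  exact b.2

/-- **The stub `h1red` from a reduction map onto a CYCLIC group with `φ_C = a •`,
`(Σ_{j<n} aʲ)(a − 1) = #C`** — the form met at a multiplicative place (`C = kˣ`, `#k = qⁿ`;
split node `a = q`, non-split node split over `k` `a = −q` with `n` even; identities
`sum_pow_mul_sub_one`, `sum_neg_pow_mul_of_even`). [folklore] -/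
theorem h1red_of_reductionMap_of_cyclic (B : AddSubgroup A) {φ : D} (φB : B →+ B)
    (hφB : ∀ b : B, ((φB b : B) : A) = φ • (b : A)) (φC : C →+ C) (r : B →+ C)
    (hr : Function.Surjective r) (hcomm : ∀ b, r (φB b) = φC (r b))
    (g : C) (hg : ∀ c : C, c ∈ AddSubgroup.zmultiples g) {N : ℕ} (hN : addOrderOf g = N)
    (hN0 : 0 < N) {a : ℤ} (hφC : ∀ c, φC c = a • c) {n : ℕ}
    (hS : (∑ j ∈ Finset.range n, a ^ j) * (a - 1) = N) :
    ∀ m ∈ B, ∑ j ∈ Finset.range n, φ ^ j • m = 0 →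
      ∃ c ∈ B, m - (φ • c - c) ∈ (r.ker.map B.subtype : Set A) :=
  h1red_of_reductionMap B φB hφB φC r hr hcomm (cyclicH1_zsmul_of_cyclic g hg hN hN0 φC hφC hS)

end Bridge

/-! ### §4 On points: p1's `hα` from the formal-group stub and a reduction map -/

section OnPoints

variable {F : Type u} [Field F] (W : WeierstrassCurve F) (L : Type u) [Field L] [Algebra F L]
  (R : Type*) [CommRing R] [IsDomain R] [IsDiscreteValuationRing R] [Algebra R L]
  [IsFractionRing R L] [(W.baseChange L).IsMinimal R]
  {C : Type*} [AddCommGroup C]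

/-- **(α) from the formal-group half and a reduction map** (p1's `hα` with `h1red` DISCHARGED
modulo its print-shaped inputs). Data: `Gal(L/F) = ⟨φ⟩`, `φⁿ = 1`; the restriction `φ_B` of `φ`
to `E₀(L)` (any endomorphism agreeing with `φ` on `E₀(L)`, e.g. built from `hstab`); a surjective
homomorphism `r : E₀(L) ↠ C` equivariant for an endomorphism `φ_C` of `C` with `H¹(⟨φ_C⟩, C) = 0`
in cyclic form (printed: the reduction `E₀(L) ↠ Ẽ_ns(k)`, *AEC* VII.2.1, and Lang / Hilbert 90
on `Ẽ_ns(k)`); and the formal-group stub `h1ker` on `E₁ := ker r` (printed: `E₁(L)`, Milne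
*ADT* I.3.8 proof). Conclusion: every `Q ∈ E(L)` with all `σ Q − Q ∈ E₀(L)` is congruent modulo
`E₀(L)` to a `Gal(L/F)`-fixed point. Nothing is booked; `h1ker` and the instantiation of `r` stay
OPEN. [cite: MilneADT2006, Ch. I Prop. 3.8] [cite: SilvermanAEC2009, VII.2 Prop. 2.1] -/
theorem hα_of_h1ker_of_reductionMap (φ : L ≃ₐ[F] L) (hφ : ∀ σ : L ≃ₐ[F] L, σ ∈ Subgroup.zpowers φ)
    {n : ℕ} (hn : φ ^ n = 1)
    (φB : (W.baseChange L).goodReductionSubgroup R →+ (W.baseChange L).goodReductionSubgroup R)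
    (hφB : ∀ b : (W.baseChange L).goodReductionSubgroup R,
      ((φB b : (W.baseChange L).goodReductionSubgroup R) : (W.baseChange L).toAffine.Point) =
        φ • (b : (W.baseChange L).toAffine.Point))
    (φC : C →+ C) (r : (W.baseChange L).goodReductionSubgroup R →+ C) (hr : Function.Surjective r)
    (hcomm : ∀ b, r (φB b) = φC (r b))
    (h90 : ∀ c : C, ∑ j ∈ Finset.range n, (⇑φC)^[j] c = 0 → ∃ c' : C, φC c' - c' = c)
    (h1ker : ∀ m ∈ (r.ker.map ((W.baseChange L).goodReductionSubgroup R).subtype :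
        Set (W.baseChange L).toAffine.Point),
      ∑ j ∈ Finset.range n, (φ ^ j) • m = 0 →
        ∃ P ∈ (r.ker.map ((W.baseChange L).goodReductionSubgroup R).subtype :
          Set (W.baseChange L).toAffine.Point), φ • P - P = m) :
    ∀ Q : (W.baseChange L).toAffine.Point,
      (∀ σ : L ≃ₐ[F] L, σ • Q - Q ∈ (W.baseChange L).goodReductionSubgroup R) →
        ∃ Q' : (W.baseChange L).toAffine.Point, (∀ σ : L ≃ₐ[F] L, σ • Q' = Q') ∧
          Q - Q' ∈ (W.baseChange L).goodReductionSubgroup R :=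
  hα_of_cyclic_of_halves W L R φ hφ hn _
    (coe_map_ker_subtype_subset ((W.baseChange L).goodReductionSubgroup R) r) h1ker
    (h1red_of_reductionMap ((W.baseChange L).goodReductionSubgroup R) φB hφB φC r hr hcomm h90)

end OnPoints

end Summit.BirchSwinnertonDyer.Rank1Residual.X11b.Three.JetchevKummer

end
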